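/-
Copyright (c) 2026 the pub-hodgecm-mathlib formalisation cell (harness21).  Prover seat hodgecm-mathlib-F0P3b-p01 (g25); E1 keeper ∕ dealer F0P3a-p03 (g29) LAST WORDS
2026-09-03T02:36:24Z «= TAKE the K2′-SENTENCE consumer rider» (E1 BRICK LEDGER v5 85b4b213, row 40″; census K2PI2-SELFEXT v1 eb22afb6, F0P2-p02 (g25)).
-/
import Summits.HodgeConjecture.HodgeConjecture.Theorems.F0P3cStCharTSK2PiTwoSelfExtSplit   -- ★ row 40 D (this seat) p853309: `exists_section_selfExtension_of_jacquet_alternative`, `two_le_finrank_intertwiningMap_normalizedInd_of_jacquet` (brings ★ G2, ★ FN, ★ J1∕J2, ★ JW)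
import Literature.RepresentationTheory.CharacterSelfExtensionJacquetAlternative              -- ★ row 40′ D′ (this seat) p853320: `jacquetAlternative_of_selfExtension_char` (brings ★ CHAR-EXT B)
import HarnessLib

/-!
# K2′-π² — THE SENTENCE: a smooth self-extension of `A = π²(ξ) ⊂ i_B(χ_ξ)` SPLITS, from the self-extension structure of its Jacquet module, a height for every
# occurring additive character, and (ND) for every non-zero one (INPUT-CLASS helper: the printed inputs are NAMED hypotheses)

Cell `pub/hodgecm-mathlib`, crux H413 = `stmt-HodgeConjecture-24833` (`--supports` lane, helper, THEOREMS ONLY: no definition ∕ instance ∕ notation ∕ named fact ∕ `sorry`).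
Namespace `Summit.HodgeConjecture.HodgeConjecture.Cruxes.H413.F0P3cStCharTSK2PiTwoSelfExtSplitSentence`.  E1 BRICK LEDGER row 40″ (consumer rider of rows 40 D ∕ 40′ D′;
RESIDUE MATRIX v1.1 K2′-π² cell «`Ext¹(π²(ξ), π²(ξ)) = 0` — every smooth self-extension of `π²(ξ)` splits», the Ext-free route).  Seat F0P3b-p01 (g25).

THE MATHEMATICS.  `t` a parabolic triple of `G` with `δ_P|_N = 1` (`hδ`; CM datum: `t := cmBorelTriple L 3 v`, ★ `deltaChar_cmBorelTriple_eq_one_of_mem_N`), `χ : M →* ℂ` a character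
with its line `χ₁` (`χ₁ m x = χ m · x`), `I₀ := i_P(χ₁) = normalizedInd t χ₁` (`= cmPrincipalSeries L 3 v χ_ξ` at the datum, ★ FN `rfl`), `A ≤ I₀` invariant IRREDUCIBLE with `Hom_G(A, I₀ ∕ A) = 0`
and Schur `dim End_G(A) = 1` ((d1), PRINT: `A = π²(ξ)`), `0 → A —ι→ τ —p→ A → 0` a SMOOTH self-extension.  INPUTS, NAMED: (b) «`r_P τ` is a self-extension of the `χ`-line» — ★ CHAR-EXT
letters `pJ u₀ e` on `N := τ.normalizedJacquet t` (at the datum: `r_B` exact ★ + «`r_B π²(ξ)` is the `χ_ξ`-line» [Keys1984 §3]); (H) HEIGHT ORACLE — every non-zero additive character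
`λ` OCCURRING in `r_P τ` (i.e. with the CHAR-EXT relation `r_P τ (m) u₀ − χ m u₀ = (χ m·λ m) e` — an unrestricted oracle would be FALSE at the datum) has a height `Λ` (`Λ(q g) = λ(proj q) + Λ g`, right-invariant under an open subgroup) (at the datum: ★ H2 `exists_height_cmBorel` once `λ` kills `T ∩ K_v`);
(ND∀≠0) «`A` does not deform to first order along the height jet of ANY non-zero additive `λ`» ([Keys1984 §3]; at the datum all such `λ = c·ord_w`, ★ LC-ADDITIVE, so ONE (ND) up to
scale).  THEN **`τ` SPLITS** (`∃ s, p ∘ s = id`): by ★ D′ ED. 2 `jacquetAlternative_of_selfExtension_char'` (the alternative WITH the occurrence relation) either `2 ≤ dim Hom_M(r_P τ, χ₁)` — then ★ D (D1) + ★ G2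
`exists_section_of_two_le_finrank` (no jet, no (ND)) — or `λ ≠ 0` with an intertwiner `θ : r_P τ → N₀(λ)` missing the sub — then §0 builds `N₀` in the JET letters, (H) gives the
height, ★ J2 `exists_linearEquiv_normalizedInd_unipotentModel_jet` the jet package `(π₁, ρ)`, (ND) at it, and ★ D `exists_section_selfExtension_of_jacquet_alternative` the section.
* §0 `exists_representation_unipotentModel_jet` (★ CHAR-EXT B's model in the JET coordinates: sub `0 × ℂ`, quotient = first coordinate).
* §1 **`selfExtension_splits_of_jacquet_selfExtension`** — THE SENTENCE at the abstract triple.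
* AT THE CM DATUM: ONE application `t := cmBorelTriple L 3 v`, `hδ := deltaChar_cmBorelTriple_eq_one_of_mem_N L 3 v` inside the consumer's proof (re-spelling the statement with
  `(normalizedInd (cmBorelTriple …) χ₁).subrepresentation A hAinv` in the binders hits the measured whnf wall of ★ J2's §3 note — HOME cert `CERT.datum.sentence` of this row).
[cite: Keys1984, §3 pp. 118–119] [cite: Rogawski1990, §12.2 p. 173] [cite: Casselman1995, §6.3] [cite: BernsteinZelevinsky1977, §2.3] [cite: Brown1982, Ch. IV §2 Prop. 2.3 p. 89]
HONEST LABEL: count-neutral INPUT-CLASS helper — (d1), (b), (H), (ND∀≠0) are PRINT hypotheses NAMED, nothing printed is asserted; h413 OPEN; HC_CM is proved only modulo the 7 printed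
citations (2 remaining named inputs hLiu418 = stmt-HodgeConjecture-24832, h413 = stmt-HodgeConjecture-24833) until rung 0 closes.

## References
* [Keys1984] D. Keys, *Principal series representations of special unitary groups over local fields*, Compositio Math. 51 (1984), §3 pp. 118–119.
* [Rogawski1990] J. D. Rogawski, *Automorphic Representations of Unitary Groups in Three Variables*, Ann. of Math. Stud. 123 (1990), §12.2 p. 173.
* [Casselman1995] W. Casselman, *Introduction to the theory of admissible representations of p-adic reductive groups* (1995), §6.3.
* [BernsteinZelevinsky1977] I. N. Bernstein, A. V. Zelevinsky, *Induced representations of reductive p-adic groups I*, Ann. Sci. ÉNS 10 (1977), §2.3.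
* [Brown1982] K. S. Brown, *Cohomology of Groups*, GTM 87 (1982), Ch. IV §2 Prop. 2.3 p. 89.
-/

set_option autoImplicit false

set_option linter.dupNamespace false

noncomputable section

open NumberField IsDedekindDomain

namespace Summit.HodgeConjecture.HodgeConjecture.Cruxes.H413.F0P3cStCharTSK2PiTwoSelfExtSplitSentence

open Literature.NumberTheory.Automorphic Literature.NumberTheory.Automorphic.UnitaryGroup Representation Literature.RepresentationTheory
open Summit.HodgeConjecture.HodgeConjecture.Cruxes.H413 Summit.HodgeConjecture.HodgeConjecture.Cruxes.H413.F0P3cStCharTSK2PiTwoSelfExtSplit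

/-! ## §0 The unipotent model in the JET coordinates -/

section Model

variable {k : Type*} [CommRing k] {M : Type*} [Monoid M]

/-- **THE UNIPOTENT MODEL `χ ⊗ [[1, λ],[0, 1]]` IN THE JET COORDINATES**: for an additive `λ` (`λ 1 = 0`, `λ(m m′) = λ m + λ m′`) there is a representation on `k × k` with
`N₀ m (w₁, w₂) = (χ m w₁, λ m (χ m w₁) + χ m w₂)` — sub `0 × k`, quotient = first coordinate (★ J1∕J2∕D's `hN₀`; ★ CHAR-EXT B `exists_representation_unipotent_model` has the
transposed convention). [cite: Brown1982, Ch. IV §2 Prop. 2.3 p. 89] [cite: Keys1984, §3 pp. 118–119] -/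
theorem exists_representation_unipotentModel_jet (χ : M →* k) (lam : M → k) (hlam1 : lam 1 = 0) (hlam : ∀ m m' : M, lam (m * m') = lam m + lam m') :
    ∃ N₀ : Representation k M (k × k), ∀ (m : M) (w : k × k), N₀ m w = (χ m * w.1, lam m * (χ m * w.1) + χ m * w.2) := by
  let T : M → (k × k) →ₗ[k] (k × k) := fun m =>
    { toFun := fun w => (χ m * w.1, lam m * (χ m * w.1) + χ m * w.2)
      map_add' := fun v w => by
        simp only [Prod.fst_add, Prod.snd_add, Prod.mk_add_mk]
        ext <;> ring
      map_smul' := fun c v => by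
        simp only [Prod.smul_fst, Prod.smul_snd, smul_eq_mul, RingHom.id_apply, Prod.smul_mk]
        ext <;> ring }
  have hT : ∀ m w, T m w = (χ m * w.1, lam m * (χ m * w.1) + χ m * w.2) := fun m w => rfl
  refine ⟨{ toFun := T, map_one' := ?_, map_mul' := fun m m' => ?_ }, fun m w => rfl⟩
  · apply LinearMap.ext
    rintro ⟨x, y⟩
    rw [hT, map_one, hlam1, Module.End.one_apply]
    ext <;> simp
  · apply LinearMap.ext
    rintro ⟨x, y⟩
    rw [Module.End.mul_apply, hT, hT, hT, map_mul, hlam]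
    ext <;> (dsimp only; ring)

end Model

/-! ## §1 THE SENTENCE at the abstract parabolic triple -/

section AnyTriple

variable {G : Type*} [Group G] [TopologicalSpace G] [IsTopologicalGroup G] (t : ParabolicTriple G) [LocallyCompactSpace ↥t.P]
  (hδ : ∀ (n : G) (hn : n ∈ t.N), deltaChar t.P ⟨n, t.N_le hn⟩ = 1)
  (χ : ↥t.M →* ℂ) (χ₁ : Representation ℂ ↥t.M ℂ) (hχ₁ : ∀ (m : ↥t.M) (x : ℂ), χ₁ m x = χ m * x)
  {X : Type*} [AddCommGroup X] [Module ℂ X] (τ : Representation ℂ G X) (hτ : τ.IsSmooth)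

include hδ hχ₁ hτ in
/-- **K2′-π² — THE SENTENCE.**  A SMOOTH self-extension `0 → A —ι→ τ —p→ A → 0` of an invariant irreducible `A ≤ I₀ = i_P(χ₁)` with `Hom_G(A, I₀ ∕ A) = 0` and Schur SPLITS, given:
(b) the self-extension structure of its Jacquet module `r_P τ` over the `χ`-line (★ CHAR-EXT letters `pJ u₀ e`), (H) a height for every non-zero additive character occurring in `r_P τ`,
and (ND∀≠0) «`A` does not deform to first order along the height jet of any non-zero additive character».  At the CM datum (`t := cmBorelTriple L 3 v`, `A = π²(ξ)`, `χ = χ_ξ`): every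
smooth self-extension of `π²(ξ)` splits — the K2′-π² cell of the residue matrix, Ext-free, modulo the NAMED printed inputs.
[cite: Keys1984, §3 pp. 118–119] [cite: Rogawski1990, §12.2 p. 173] [cite: Casselman1995, §6.3] [cite: BernsteinZelevinsky1977, §2.3] -/
theorem selfExtension_splits_of_jacquet_selfExtension (hχ : ∀ m, IsUnit (χ m))
    -- (a) the self-extension of `A ≤ I₀` (★ G2 letters; (d1) PRINT)
    (A : Submodule ℂ (SmoothInd t.P (Representation.twist (χ₁.comp t.proj) (rootDeltaChar t.P))))
    (hAinv : ∀ g, A ≤ A.comap (Representation.normalizedInd t χ₁ g))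
    (hAirr : ∀ B : Submodule ℂ (SmoothInd t.P (Representation.twist (χ₁.comp t.proj) (rootDeltaChar t.P))), B ≤ A →
      (∀ g, B ≤ B.comap (Representation.normalizedInd t χ₁ g)) → B = ⊥ ∨ B = A)
    (hHom0 : ∀ ψ : IntertwiningMap ((Representation.normalizedInd t χ₁).subrepresentation A hAinv) ((Representation.normalizedInd t χ₁).quotient A hAinv), ψ = 0)
    (hSchur : Module.finrank ℂ (IntertwiningMap ((Representation.normalizedInd t χ₁).subrepresentation A hAinv)
      ((Representation.normalizedInd t χ₁).subrepresentation A hAinv)) = 1)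
    (ι : IntertwiningMap ((Representation.normalizedInd t χ₁).subrepresentation A hAinv) τ)
    (p : IntertwiningMap τ ((Representation.normalizedInd t χ₁).subrepresentation A hAinv))
    (hp : Function.Surjective p) (hexact : LinearMap.ker p.toLinearMap = LinearMap.range ι.toLinearMap)
    -- (b) «`r_P τ` is a self-extension of the `χ`-line» (★ CHAR-EXT ∕ D′ letters; PRINT input class)
    (pJ : (t.restrict τ).Coinvariants →ₗ[ℂ] ℂ) (hquot : ∀ (m : ↥t.M) (u : (t.restrict τ).Coinvariants), pJ (τ.normalizedJacquet t m u) = χ m * pJ u)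
    (hker : ∀ (m : ↥t.M) (u : (t.restrict τ).Coinvariants), pJ u = 0 → τ.normalizedJacquet t m u = χ m • u)
    {u₀ e : (t.restrict τ).Coinvariants} (hu₀ : pJ u₀ = 1) (he : pJ e = 0)
    (hline : ∀ w : (t.restrict τ).Coinvariants, pJ w = 0 → ∃ c : ℂ, w = c • e) (hfree : ∀ c : ℂ, c • e = 0 → c = 0)
    -- (H) HEIGHT ORACLE for the non-zero additive characters OCCURRING in `r_P τ` (occurrence antecedent: the CHAR-EXT relation; ★ H2 at the datum once `λ` kills `T ∩ K_v`)
    (hH : ∀ lam : ↥t.M → ℂ, lam 1 = 0 → (∀ m m' : ↥t.M, lam (m * m') = lam m + lam m') → (∃ m, lam m ≠ 0) →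
      (∀ m : ↥t.M, τ.normalizedJacquet t m u₀ - χ m • u₀ = (χ m * lam m) • e) →
      ∃ (Λ : G → ℂ) (KΛ : Subgroup G), IsOpen (KΛ : Set G) ∧ (∀ (x κ : G), κ ∈ KΛ → Λ (x * κ) = Λ x) ∧
        ∀ (q : ↥t.P) (g : G), Λ ((q : G) * g) = lam (t.proj q) + Λ g)
    -- (ND∀≠0): `A` does not deform along the height jet of any non-zero additive character OCCURRING in `r_P τ` (PRINT [Keys1984 §3])
    (hND : ∀ (lam : ↥t.M → ℂ), (∃ m, lam m ≠ 0) → (∀ m : ↥t.M, τ.normalizedJacquet t m u₀ - χ m • u₀ = (χ m * lam m) • e) →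
      ∀ (Λ : G → ℂ), (∀ (q : ↥t.P) (g : G), Λ ((q : G) * g) = lam (t.proj q) + Λ g) →
      ∀ (π₁ : G → Module.End ℂ (SmoothInd t.P (Representation.twist (χ₁.comp t.proj) (rootDeltaChar t.P)))),
        (∀ (g : G) (w : SmoothInd t.P (Representation.twist (χ₁.comp t.proj) (rootDeltaChar t.P))) (x : G), (π₁ g w).toFun x = (Λ (x * g) - Λ x) • w.toFun (x * g)) →
          ¬ ∃ Lft : A →ₗ[ℂ] SmoothInd t.P (Representation.twist (χ₁.comp t.proj) (rootDeltaChar t.P)), ∀ (g : G) (a : A),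
            π₁ g (a : SmoothInd t.P (Representation.twist (χ₁.comp t.proj) (rootDeltaChar t.P))) + Representation.normalizedInd t χ₁ g (Lft a) -
              Lft ((Representation.normalizedInd t χ₁).subrepresentation A hAinv g a) ∈ A) :
    ∃ s : IntertwiningMap ((Representation.normalizedInd t χ₁).subrepresentation A hAinv) τ,
      p.comp s = IntertwiningMap.id ((Representation.normalizedInd t χ₁).subrepresentation A hAinv) := by
  -- the Jacquet alternative of the self-extension `r_P τ` of the `χ`-line (★ D′)
  rcases jacquetAlternative_of_selfExtension_char' (τ.normalizedJacquet t) χ hχ pJ hquot hker hu₀ he hline hfree χ₁ hχ₁ with h2 | ⟨lam, hlam1, hlam, hne, hocc, hθ⟩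
  · -- SPLIT branch: `2 ≤ dim Hom_M(r_P τ, χ₁) ⇒ 2 ≤ dim Hom_G(τ, I₀)` (★ D (D1)) ⇒ section by Hom-count (★ G2), no jet, no (ND)
    exact exists_section_of_two_le_finrank (Representation.normalizedInd t χ₁) A hAinv hAirr hHom0 hSchur τ ι p hp hexact
      (two_le_finrank_intertwiningMap_normalizedInd_of_jacquet t hδ χ₁ τ hτ h2)
  · -- NON-SPLIT branch: the unipotent model in the JET letters, a height, ★ J2's jet package, (ND) at it, ★ D's assembly
    obtain ⟨N₀, hN₀⟩ := exists_representation_unipotentModel_jet χ lam hlam1 hlam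
    obtain ⟨θ, y, hy⟩ := hθ N₀ hN₀
    obtain ⟨Λ, KΛ, hKΛ, hΛK, hΛ⟩ := hH lam hlam1 hlam hne hocc
    have hN₀' : ∀ (m : ↥t.M) (w : ℂ × ℂ), N₀ m w = (χ₁ m w.1, lam m • χ₁ m w.1 + χ₁ m w.2) := fun m w => by
      rw [hN₀, hχ₁, hχ₁, smul_eq_mul]
    obtain ⟨Ψ, π₁, ρ, -, hπ₁, -, -, hρ, -⟩ :=
      F0P3cStCharTSJetAtDatum.exists_linearEquiv_normalizedInd_unipotentModel_jet t χ₁ lam N₀ hN₀' Λ hΛ KΛ hKΛ hΛK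
    exact exists_section_selfExtension_of_jacquet_alternative t hδ χ₁ τ lam N₀ hN₀' Λ hΛ KΛ hKΛ hΛK π₁ hπ₁ ρ hρ hτ
      A hAinv hAirr (hND lam hne hocc Λ hΛ π₁ hπ₁) hHom0 hSchur ι p hp hexact (Or.inr ⟨θ, y, hy⟩)

end AnyTriple

end Summit.HodgeConjecture.HodgeConjecture.Cruxes.H413.F0P3cStCharTSK2PiTwoSelfExtSplitSentence

end
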